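import Mathlib.Tactic
import HarnessLib

/-!
# R-W WINDOW-TABLE, W3 «UNIFORM LEMMA» lane, INHABITED side — generic integer lemmas for UNIFORM-IN-`l` cell certificates
# (row «W:INHABITED-BANDS», abc-iut-plan g10 C-R72)

PROOF-ONLY file (D-0012; 0 definitions, 0 `Prop` facts; pure integer arithmetic) of the abc-iut cell — D-0079 RESCUE sub-cell R-W
«WINDOW Θ-SIDE INEQUALITY», seat abc-iut-W-num-6 (gen 3; numerics crew 6/6, band/wrapper specialist). The inhabited-side
analogue of this seat's `LinUniformBand.test_of_cert` (p470513): the licence socket's integer cell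
`e·⌊(j²P − j·D − (j+1)·ρin)/e⌋ + (j+1)·ρout ≤ P` (abc-iut-w4-d036's exact cell p460046/p460573, orders form
`Cor312Prov.licence_settingPrVolSharp_pilotDataOfK_of_orders_rat` of abc-iut-W-row-1) is implied by its FLOOR-FREE form
(`InhBand.cell_of_noFloor`), and a floor-free form that is a CONVEX quadratic in the label `j` holds at every label
`1 ≤ j ≤ (l−1)/2` as soon as it holds at the two ends `j = 1` and `j = (l−1)/2` (`InhBand.quad_nonpos_of_ends`, the chord
above a convex parabola, denominators cleared: `4·f((l−1)/2) = A(l−1)² + 2B(l−1) + 4C`). Both ends are then polynomial in `l`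
(and linear in the multiplier `n` of the ramification index `e = e₀·l·n`), which is what makes ONE certificate decide EVERY level
`l ≥ L₀` — abc-iut-rw-num-lead's INHABITED-UNIFORM-CERTS.tsv (sha16 572449ea63f1d45c) recipe, re-derived by this seat's second engine
(HOME/abc-iut-W-num-6/inhband/engine.py) with the kernel's one-sided inputs. Consumers: `InhUniformBandCells<Triple>.lean` /
`InhUniformBand<Triple>.lean`. HONEST SCOPE: integer arithmetic only; nothing here bears on the printed inequality of [IUTchIII]
Cor. 3.12; no abc claim. [folklore]
-/

namespace Summit.ABC.IUTFork.Conditional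

/-! ## §1. Dropping the floor -/

/-- **The socket's integer cell follows from its floor-free form**: `e·⌊x/e⌋ ≤ x` for `e > 0`, so
`j²P − jD − (j+1)ρin + (j+1)ρout ≤ P` gives `e·⌊(j²P − jD − (j+1)ρin)/e⌋ + (j+1)ρout ≤ P`. [folklore] -/
theorem InhBand.cell_of_noFloor (e P D ρin ρout j : ℤ) (he : 0 < e)
    (h : j ^ 2 * P - j * D - (j + 1) * ρin + (j + 1) * ρout ≤ P) :
    e * ((j ^ 2 * P - j * D - (j + 1) * ρin) / e) + (j + 1) * ρout ≤ P := by
  have hfloor := Int.mul_ediv_self_le (k := e) (x := j ^ 2 * P - j * D - (j + 1) * ρin) he.ne'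
  linarith

/-! ## §2. A convex quadratic in the label is nonpositive on `[1, (l−1)/2]` once it is at both ends -/

/-- **Chord above a convex parabola, denominators cleared.** For `A ≥ 0`, `l ≥ 3`, an integer label `1 ≤ j` with
`2j + 1 ≤ l`: if `f(1) = A + B + C ≤ 0` and `4·f((l−1)/2) = A(l−1)² + 2B(l−1) + 4C ≤ 0` then `f(j) = Aj² + Bj + C ≤ 0`.
Identity: `2(l−3)·f(j) = 2(l−1−2j)·f(1) + (j−1)·4f((l−1)/2) − A(j−1)(l−1−2j)(l−3)`. [folklore] -/
theorem InhBand.quad_nonpos_of_ends (A B C j l : ℤ) (hA : 0 ≤ A) (hl : 3 ≤ l) (hj : 1 ≤ j) (hjl : 2 * j + 1 ≤ l)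
    (h1 : A + B + C ≤ 0) (hM : A * (l - 1) ^ 2 + 2 * B * (l - 1) + 4 * C ≤ 0) :
    A * j ^ 2 + B * j + C ≤ 0 := by
  have hj1 : 0 ≤ j - 1 := by linarith
  have hlj : 0 ≤ l - 1 - 2 * j := by linarith
  have hl3 : 0 ≤ l - 3 := by linarith
  have key : 2 * (l - 3) * (A * j ^ 2 + B * j + C) =
      2 * (l - 1 - 2 * j) * (A + B + C) + (j - 1) * (A * (l - 1) ^ 2 + 2 * B * (l - 1) + 4 * C) -
        A * (j - 1) * (l - 1 - 2 * j) * (l - 3) := by ring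
  have hprod : 0 ≤ A * (j - 1) * (l - 1 - 2 * j) * (l - 3) := by positivity
  have hneg : 2 * (l - 3) * (A * j ^ 2 + B * j + C) ≤ 0 := by
    rw [key]; nlinarith [mul_nonpos_iff.mpr (Or.inl ⟨hlj, h1⟩), mul_nonpos_iff.mpr (Or.inl ⟨hj1, hM⟩)]
  rcases eq_or_lt_of_le hl with h3 | h3
  · -- `l = 3`: then `j = 1`
    have hj' : j = 1 := by omega
    subst hj'; linarith
  · have hpos : 0 < 2 * (l - 3) := by linarith
    by_contra hcon
    push Not at hcon
    have := mul_pos hpos hcon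
    linarith

/-- **Floor-free endpoint form, linear in the index multiplier.** If `g(n) = n·α + β` with `α ≤ 0` and `α + β ≤ 0` then `g(n) ≤ 0`
for every `n ≥ 1`. [folklore] -/
theorem InhBand.linear_nonpos_of_one_le (α β n : ℤ) (hn : 1 ≤ n) (hα : α ≤ 0) (h1 : α + β ≤ 0) : n * α + β ≤ 0 := by
  nlinarith

/-- **A downward quadratic past its certificate point.** If `c₂ ≤ 0`, `q(L₀) ≤ 0` and `q'(L₀) = c₁ + 2c₂L₀ ≤ 0` then
`q(l) = c₂l² + c₁l + c₀ ≤ 0` for every `l ≥ L₀` (Taylor at `L₀`). [folklore] -/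
theorem InhBand.quad_nonpos_from (c₂ c₁ c₀ L₀ l : ℤ) (hl : L₀ ≤ l) (hc₂ : c₂ ≤ 0) (hval : c₂ * L₀ ^ 2 + c₁ * L₀ + c₀ ≤ 0)
    (hder : c₁ + 2 * c₂ * L₀ ≤ 0) : c₂ * l ^ 2 + c₁ * l + c₀ ≤ 0 := by
  have hd : 0 ≤ l - L₀ := by linarith
  have key : c₂ * l ^ 2 + c₁ * l + c₀ =
      (c₂ * L₀ ^ 2 + c₁ * L₀ + c₀) + (c₁ + 2 * c₂ * L₀) * (l - L₀) + c₂ * (l - L₀) ^ 2 := by ring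
  rw [key]
  nlinarith [mul_nonneg hd hd, mul_nonpos_iff.mpr (Or.inr ⟨hder, hd⟩), mul_nonpos_iff.mpr (Or.inr ⟨hc₂, mul_nonneg hd hd⟩)]

end Summit.ABC.IUTFork.Conditional
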